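import Summits.QuantumFields.YangMills.Theorems.FluctuationComparisonRegPrIntLPersistenceFromHeightwiseBounds
import Summits.QuantumFields.YangMills.Theorems.FluctuationComparisonRegPrIntLPersistenceKFree
import HarnessLib

/-!
# `FluctuationComparisonRegPrIntLPersistenceFromThm1` — LINE g22-2∕g22-4, row PERS₁∘ `OneLevelPersistenceIntCan`: PERS₁∘ ⟸ BAŁABAN'S HEIGHTWISE STABILITY BOUNDS ALONE
# (crux `UnitScaleTilt.FluctuationComparisonRegPrIntL`, stmt-QuantumFields-20520; final knit of the σ-free persistence road: ✓`…PersistenceFromHeightwiseBounds` (LEAD w3-20520 g18: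
# ⟨UP⟩∕⟨LOW⟩ ⟸ lit `T3HeightwiseDensityBounds` schemas) ∘ ✓`…PersistenceKFree` (ym3-torus-px8 g14: PERS₁∘ ⟸ ⟨UP⟩ + ⟨LOW on S′⟩, the K-free side HYPOTHESIS-FREE over
# ym3-torus-px20 g11's local charge ✓`…HaarTubeLocalCharge`, ym-ust-20520-w4 g18's l.s.c. engine ✓`…HaarTubeLscFloor`, GEOM∘ ✓`…InteriorSectionMeasurable`, ⟨FLOOR₁⟩ ✓`…HaarFloorDepthOne`))

Cell `ym3-torus` (YM ladder rung R3 = continuum SU(2) Yang–Mills on T³ — a RUNG, NOT the Clay problem: not d = 4, not infinite volume, not a mass gap);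
width seat `ym-ust-20520-w3` (gen 18, LEAD-20520); helper `--supports stmt-QuantumFields-20520`.  THEOREMS ONLY (0 `def`, 0 `sorry`, default heartbeats).

WHAT.  ★★★★`oneLevelPersistenceIntCan_of_heightwiseBounds` — **PERS₁∘ VERBATIM from TWO K-UNIFORM DENSITY LETTERS AND NOTHING ELSE**: in PERS₁∘'s shared prefix, after `F, γ`:
(i) lit `HeightwiseUpperBound F γ` ([Balaban1985UV3] (5) upper at every height over (6) — Thm 1 p. 257 read heightwise for the pinned `ℰp` densities; ym-ust-20520-w5 g17's
✓`…HeightwiseQuotientOfBounds5` derives it from print's two-sided (5) with (6) discharged on the tower), and (ii) for every `J` a K-UNIFORM a.e. lower bound of the normalised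
height density `Z_K⁻¹ρ_{K−(J+1)}` on the level-`(J+1)` interior window `{PlaqSmall θ_{J+1}(c·b₀)}` ((5), lower half).  Everything K-free (one-step Haar kinematics of `ℰp`,
measurable selection, charts, l.s.c. floors) is a THEOREM consumed by name.
HONEST SCOPE.  A door: (i)–(ii) are HYPOTHESES = Bałaban's UV-stability Theorem 1 at height `K−J−1` (XL, the cell's construction statement for `ℰp`); PERS₁∘, POS∘, LFR♯ᶜ∘, S2β,
20520, `YM3TorusSU2` NOT proved; the Yang–Mills mass gap is NOT proved.  HYP-SAT (cell RULING №42): (i)–(ii) are predicates in `(F, γ)` with constants before `K`; printed for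
Bałaban's run objects (Thm 1), not discharged in the tree.
References: [Balaban1985UV3] (5) p. 256, (6) p. 257, Thm 1 p. 257, (47) p. 267; [Balaban1985Averaging] (10) p. 19, Prop. 1 p. 22.
-/

noncomputable section

set_option autoImplicit false

open MeasureTheory Filter Topology Set
open scoped ENNReal NNReal
open Literature.MathematicalPhysics.QuantumFieldTheory.Balaban1983to89
open Literature.MathematicalPhysics.QuantumFieldTheory.Balaban1983to89.T3ContinuumYM3Torus
open Literature.MathematicalPhysics.QuantumFieldTheory.Balaban1983to89.T3NestedUnitLaws
open Literature.MathematicalPhysics.QuantumFieldTheory.Balaban1983to89.T3UnitLawDensityEML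
open Literature.MathematicalPhysics.QuantumFieldTheory.Balaban1983to89.T3UnitScaleTilt
open Literature.MathematicalPhysics.QuantumFieldTheory.Balaban1983to89.T3TiltDescent
open Literature.MathematicalPhysics.QuantumFieldTheory.Balaban1983to89.T3HeightwiseDensityBounds
open Literature.MathematicalPhysics.QuantumFieldTheory.Balaban1983to89.Missing
open Literature.MathematicalPhysics.QuantumFieldTheory.Balaban1983to89.T4Continuum
open Summit.QuantumFields.YangMills.Theorems.FluctuationComparisonRegPrIntLPersistenceFromHeightwiseBounds

namespace Summit.QuantumFields.YangMills.Theorems.FluctuationComparisonRegPrIntLPersistenceFromThm1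

/-- ★★★★ **PERS₁∘ `OneLevelPersistenceIntCan` (LINE g22-4 `persistence_geometry.lean` 970dcf79 ll.93–101) VERBATIM ⟸ BAŁABAN'S HEIGHTWISE STABILITY BOUNDS ALONE**: hypothesis =
PERS₁∘'s prefix, then after `F, γ`: `HeightwiseUpperBound F γ` (lit schema, [Balaban1985UV3] (5)∕(6)) and, for every `J`, `∃ cl > 0, ∀ K ≥ J+1, dU_{J+1}`-a.e. on
`{PlaqSmall θ_{J+1}(c·b₀)}`: `cl ≤ Z_K⁻¹·heightDensity F γ hJK univ` ((5), lower half, on the interior window).  Proof: ✓`up_of_heightwiseUpperBound` + ✓`low_of_heightwiseLowerDensity`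
build ✓`…PersistenceKFree.oneLevelPersistenceIntCan_of_up_low`'s ⟨UP⟩+⟨LOW⟩ bundle; the K-free side is px8∕px20∕w4's theorems.  HONEST SCOPE: the two letters ARE Theorem 1's
content and are NOT proved here. [cite: Balaban1985UV3, (5) p.256, (6) p.257, Thm 1 p.257; Balaban1985Averaging, Prop. 1 p.22] -/
theorem oneLevelPersistenceIntCan_of_heightwiseBounds
    (h : ∀ (L : ℕ), ∃ c₀ : ℝ, 0 < c₀ ∧ c₀ ≤ 1 ∧ ∀ (c : ℝ), 0 < c → c ≤ c₀ → ∃ pS : ℝ, ∀ (b₀ p₀ : ℝ), 0 < b₀ → pS ≤ p₀ → 0 < p₀ →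
      ∃ γ₁ : ℝ, 0 < γ₁ ∧ ∀ (F : T3Family) (γ : ℝ), F.L = L → 0 < γ → γ ≤ γ₁ →
        HeightwiseUpperBound F γ ∧
        ∀ (J : ℕ), ∃ cl : ℝ, 0 < cl ∧ ∀ (K : ℕ) (hJK : J + 1 ≤ K),
          ∀ᵐ V ∂(fieldMeasure (F.P (J + 1)) 0 (Matrix.specialUnitaryGroup (Fin 2) ℂ)), PlaqSmall (θBal F.L γ (c * b₀) p₀ (J + 1)) V →
            cl ≤ (partitionFn (G := Matrix.specialUnitaryGroup (Fin 2) ℂ) (F.P K) ((F.scheme ℰp γ).β K))⁻¹ * heightDensity F γ hJK Set.univ V) :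
    ∀ (L : ℕ), ∃ c₀ : ℝ, 0 < c₀ ∧ c₀ ≤ 1 ∧ ∀ (c : ℝ), 0 < c → c ≤ c₀ → ∃ pS : ℝ, ∀ (b₀ p₀ : ℝ), 0 < b₀ → pS ≤ p₀ → 0 < p₀ →
      ∃ γ₁ : ℝ, 0 < γ₁ ∧ ∀ (F : T3Family) (γ : ℝ), F.L = L → 0 < γ → γ ≤ γ₁ →
        ∀ (J : ℕ), ∃ q : ℝ, 0 < q ∧ ∀ (K : ℕ) (hJK : J + 1 ≤ K)
          (B : Set (GaugeField (F.P J) 0 (Matrix.specialUnitaryGroup (Fin 2) ℂ))), MeasurableSet B →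
            B ⊆ {U | PlaqSmall (θBal F.L γ (c * b₀) p₀ J) U} →
            ENNReal.ofReal q * gibbsK F ℰp γ K (descendTo F ℰp J K ((Nat.le_succ J).trans hJK) ⁻¹' B) ≤
              gibbsK F ℰp γ K (descendTo F ℰp J K ((Nat.le_succ J).trans hJK) ⁻¹' B ∩
                descendTo F ℰp (J + 1) K hJK ⁻¹' {V | PlaqSmall (θBal F.L γ (c * b₀) p₀ (J + 1)) V}) := by
  refine Summit.QuantumFields.YangMills.Theorems.FluctuationComparisonRegPrIntLPersistenceKFree.oneLevelPersistenceIntCan_of_up_low fun L => ?_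
  obtain ⟨c₀, hc₀, hc₀1, hc⟩ := h L
  refine ⟨c₀, hc₀, hc₀1, fun c hcpos hcle => ?_⟩
  obtain ⟨pS, hpS⟩ := hc c hcpos hcle
  refine ⟨pS, fun b₀ p₀ hb₀ hpS' hp₀ => ?_⟩
  obtain ⟨γ₁, hγ₁, hγ₁F⟩ := hpS b₀ p₀ hb₀ hpS' hp₀
  refine ⟨γ₁, hγ₁, fun F γ hFL hγ hγle J => ?_⟩
  obtain ⟨hup, hJ⟩ := hγ₁F F γ hFL hγ hγle
  obtain ⟨cl, hcl, hlow⟩ := hJ J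
  obtain ⟨C, hC, hUP⟩ := up_of_heightwiseUpperBound F hγ.le hup J
  exact ⟨C, cl, hC, hcl, fun K hJK => ⟨hUP K hJK _,
    low_of_heightwiseLowerDensity F hγ.le hJK (measurableSet_plaqSmall _) (hlow K hJK)⟩⟩

end Summit.QuantumFields.YangMills.Theorems.FluctuationComparisonRegPrIntLPersistenceFromThm1

end
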